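import Literature.NumberTheory.LFunctions.VanDerCorputZeta
import HarnessLib

/-!
# Van der Corput's second-derivative test in DISCRETE form (second differences) and Abel summation
# with an amplitude that vanishes at the transitions

Topic `Literature/NumberTheory/LFunctions`, sequel to `VanDerCorputZeta.lean` (whose discrete Kusmin–Landau
inequality `VdC.kusminLandau` and fibre argument `VdC.secondDerivTest_core` are the model).  Everything here is
PROVED; no definitions besides the hypothesis structure, no named facts.

In the two-dimensional van der Corput method the "transverse" sums `∑_b A(b) e(φ(b))` have a phase `φ`
that is only given at integers (a constrained critical value), with two-sided bounds for its SECOND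
DIFFERENCES; this file provides the corresponding form of van der Corput's second-derivative test
(Graham–Kolesnik, Theorem 2.2), with the derivative `f'` of the continuous statement replaced by the
increment `θ(n) = φ(n+1) - φ(n)`:

* `VdC.SecondDiffHyp φ a b λ h` — the hypothesis `λ(n₂ - n₁) ≤ θ(n₂) - θ(n₁) ≤ hλ(n₂ - n₁)` for
  `a < n₁ ≤ n₂ ≤ b`;
* `VdC.secondDiffTest_core` — **`‖∑_{a<n≤b} e(φ(n))‖ ≤ 12 (h (b - a) λ^{1/2} + λ^{-1/2})`** under
  `SecondDiffHyp` (`λ > 0`, `h ≥ 1`): the integers are fibred by `⌊θ(n)⌋`; on a fibre, the `≤ δ/λ + 1`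
  points with `θ < ν + δ`, the `≤ δ/λ + 1` points with `θ > ν + 1 - δ`, and Kusmin–Landau in between;
  `≤ hλ(b - a) + 2` fibres; `δ = λ^{1/2}`;
* `VdC.secondDiffTest` — the same from the LOCAL hypothesis `λ ≤ φ(n+2) - 2φ(n+1) + φ(n) ≤ hλ`
  (`a < n`, `n + 1 ≤ b`);
* `VdC.sum_Ioc_mul_eq_abel`, `VdC.norm_sum_mul_le_of_variation` — **Abel summation with an amplitude of
  bounded variation**: `‖∑_{a<n≤b} A(n) z(n)‖ ≤ (‖A(a+1)‖ + ∑_{a<m<b} ‖A(m+1) - A(m)‖) · B` whenever all the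
  tail sums `∑_{m<n≤b} z(n)` (`a ≤ m ≤ b`) have norm `≤ B`.

## References

* S. W. Graham, G. Kolesnik, *Van der Corput's Method of Exponential Sums*, LMS LN 126 (1991), Thm 2.1
  (Kusmin–Landau), Thm 2.2 (second-derivative test) and its proof. [GrahamKolesnik1991]
* E. C. Titchmarsh, *The Theory of the Riemann Zeta-Function*, 2nd ed. (1986), Thm 5.9. [Titchmarsh1986]
-/

noncomputable section

open Finset Real

namespace Literature.NumberTheory.LFunctions
namespace VdC

/-! ### The hypothesis and its elementary consequences -/

/-- The discrete second-derivative hypothesis: the increments `θ(n) = φ(n+1) - φ(n)` satisfy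
`λ(n₂ - n₁) ≤ θ(n₂) - θ(n₁) ≤ hλ(n₂ - n₁)` for `a < n₁ ≤ n₂ ≤ b`. [folklore] -/
structure SecondDiffHyp (φ : ℤ → ℝ) (a b : ℤ) (lam h : ℝ) : Prop where
  incr : ∀ n₁ n₂ : ℤ, a < n₁ → n₁ ≤ n₂ → n₂ ≤ b →
    lam * (n₂ - n₁) ≤ (φ (n₂ + 1) - φ n₂) - (φ (n₁ + 1) - φ n₁) ∧
      (φ (n₂ + 1) - φ n₂) - (φ (n₁ + 1) - φ n₁) ≤ h * lam * (n₂ - n₁)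

namespace SecondDiffHyp

variable {φ : ℤ → ℝ} {a b : ℤ} {lam h : ℝ}

/-- The increments are nondecreasing. [folklore] -/
theorem mono (H : SecondDiffHyp φ a b lam h) (hlam : 0 < lam) {n₁ n₂ : ℤ} (h₁ : a < n₁) (h12 : n₁ ≤ n₂)
    (h₂ : n₂ ≤ b) : φ (n₁ + 1) - φ n₁ ≤ φ (n₂ + 1) - φ n₂ := by
  have := (H.incr n₁ n₂ h₁ h12 h₂).1
  have h0 : (0 : ℝ) ≤ lam * (n₂ - n₁) := mul_nonneg hlam.le (by exact_mod_cast sub_nonneg.2 h12)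
  linarith

/-- Kusmin–Landau on an integer interval `[m, M] ⊆ (a, b]` on which `ν + δ ≤ θ ≤ ν + 1 - δ` at the ends.
[cite: GrahamKolesnik1991, Thm 2.1] -/
theorem kl_interval (H : SecondDiffHyp φ a b lam h) (hlam : 0 < lam) {m M ν : ℤ} {δ : ℝ}
    (hδ : 0 < δ) (hδ2 : δ ≤ 1 / 2) (ham : a < m) (hMb : M ≤ b)
    (hm : (ν : ℝ) + δ ≤ φ (m + 1) - φ m) (hM : φ (M + 1) - φ M ≤ ν + 1 - δ) :
    ‖∑ n ∈ Finset.Icc m M, e (φ n)‖ ≤ 2 / δ := by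
  rcases lt_or_ge M m with hMm | hmM
  · rw [Finset.Icc_eq_empty (not_le.2 hMm), sum_empty, norm_zero]; positivity
  apply kusminLandau (φ := φ) (ν := ν) hδ hδ2
  · intro n h1 h2
    have hlo := H.mono hlam ham h1 (by omega)
    have hhi := H.mono hlam (by omega : a < n) h2.le hMb
    constructor <;> linarith
  · intro n h1 h2
    have := H.mono hlam (by omega : a < n) (by omega : n ≤ n + 1) (by omega)
    simpa [add_assoc] using this

/-- Bound for one fibre `{n ∈ (a, b] : ⌊θ(n)⌋ = ν}`: at most `δ/λ + 1` points with `θ < ν + δ`, at most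
`δ/λ + 1` with `θ > ν + 1 - δ`, and Kusmin–Landau in between. [cite: GrahamKolesnik1991, Thm 2.2 (proof)] -/
theorem fibre_bound (H : SecondDiffHyp φ a b lam h) (hlam : 0 < lam) (ν : ℤ)
    {δ : ℝ} (hδ : 0 < δ) (hδ2 : δ ≤ 1 / 2) :
    ‖∑ n ∈ (Finset.Ioc a b).filter (fun n : ℤ => ⌊φ (n + 1) - φ n⌋ = ν), e (φ n)‖
      ≤ 2 * (δ / lam + 1) + 2 / δ := by
  set θ : ℤ → ℝ := fun n => φ (n + 1) - φ n with hθdef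
  set F : Finset ℤ := (Finset.Ioc a b).filter (fun n : ℤ => ⌊θ n⌋ = ν) with hFdef
  have hmemF : ∀ n : ℤ, n ∈ F ↔ n ∈ Finset.Ioc a b ∧ ⌊θ n⌋ = ν := by
    intro n; rw [hFdef, Finset.mem_filter]
  set P : ℤ → Prop := fun n => θ n < ν + δ with hPdef
  set Q : ℤ → Prop := fun n => θ n ≤ ν + 1 - δ with hQdef
  have hsplit : ∑ n ∈ F, e (φ n)
      = ∑ n ∈ F.filter P, e (φ n) + (∑ n ∈ (F.filter (fun n : ℤ => ¬ P n)).filter Q, e (φ n)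
        + ∑ n ∈ (F.filter (fun n : ℤ => ¬ P n)).filter (fun n : ℤ => ¬ Q n), e (φ n)) := by
    rw [Finset.sum_filter_add_sum_filter_not, Finset.sum_filter_add_sum_filter_not]
  -- A: `ν ≤ θ n < ν + δ`
  have hA : ((F.filter P).card : ℝ) ≤ δ / lam + 1 := by
    apply card_le_of_diam (by positivity)
    intro n₁ hn₁ n₂ hn₂ h12
    rw [Finset.mem_filter, hmemF, Finset.mem_Ioc] at hn₁ hn₂
    have h1 : (ν : ℝ) ≤ θ n₁ := by
      have := Int.floor_le (θ n₁); rw [hn₁.1.2] at this; exact this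
    have h2 : θ n₂ < ν + δ := hn₂.2
    have h3 := (H.incr n₁ n₂ hn₁.1.1.1 h12 hn₂.1.1.2).1
    have h12' : ((n₁ : ℤ) : ℝ) ≤ n₂ := by exact_mod_cast h12
    rw [le_div_iff₀ hlam]
    simp only [hθdef] at h1 h2
    linarith
  -- B: `ν + 1 - δ < θ n < ν + 1`
  have hB : (((F.filter (fun n : ℤ => ¬ P n)).filter (fun n : ℤ => ¬ Q n)).card : ℝ) ≤ δ / lam + 1 := by
    apply card_le_of_diam (by positivity)
    intro n₁ hn₁ n₂ hn₂ h12
    simp only [Finset.mem_filter, hmemF, Finset.mem_Ioc] at hn₁ hn₂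
    have h1 : (ν : ℝ) + 1 - δ < θ n₁ := not_le.1 hn₁.2
    have h2 : θ n₂ < ν + 1 := by
      have := Int.lt_floor_add_one (θ n₂)
      rw [hn₂.1.1.2] at this; exact this
    have h3 := (H.incr n₁ n₂ hn₁.1.1.1.1 h12 hn₂.1.1.1.2).1
    rw [le_div_iff₀ hlam]
    simp only [hθdef] at h1 h2
    linarith
  -- G: `ν + δ ≤ θ n ≤ ν + 1 - δ`
  have hG : ‖∑ n ∈ (F.filter (fun n : ℤ => ¬ P n)).filter Q, e (φ n)‖ ≤ 2 / δ := by
    set G : Finset ℤ := (F.filter (fun n : ℤ => ¬ P n)).filter Q with hGdef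
    have hmemG : ∀ n : ℤ, n ∈ G ↔ n ∈ Finset.Ioc a b ∧ (ν : ℝ) + δ ≤ θ n ∧ θ n ≤ ν + 1 - δ := by
      intro n
      simp only [hGdef, Finset.mem_filter, hmemF, hPdef, hQdef, not_lt]
      constructor
      · rintro ⟨⟨⟨h1, _⟩, h2⟩, h3⟩; exact ⟨h1, h2, h3⟩
      · rintro ⟨h1, h2, h3⟩
        refine ⟨⟨⟨h1, ?_⟩, h2⟩, h3⟩
        rw [Int.floor_eq_iff]
        constructor <;> linarith
    rcases G.eq_empty_or_nonempty with hGe | hGne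
    · rw [hGe, sum_empty, norm_zero]; positivity
    have hbetween : ∀ n₁ ∈ G, ∀ n₂ ∈ G, ∀ n, n₁ ≤ n → n ≤ n₂ → n ∈ G := by
      intro n₁ hn₁ n₂ hn₂ n h1 h2
      rw [hmemG] at hn₁ hn₂ ⊢
      have hnI : n ∈ Finset.Ioc a b := by
        rw [Finset.mem_Ioc] at hn₁ hn₂ ⊢
        exact ⟨lt_of_lt_of_le hn₁.1.1 h1, h2.trans hn₂.1.2⟩
      rw [Finset.mem_Ioc] at hn₁ hn₂ hnI
      refine ⟨Finset.mem_Ioc.2 hnI, ?_, ?_⟩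
      · have := H.mono hlam hn₁.1.1 h1 hnI.2
        simp only [hθdef] at hn₁ ⊢
        linarith [hn₁.2.1]
      · have := H.mono hlam hnI.1 h2 hn₂.1.2
        simp only [hθdef] at hn₂ ⊢
        linarith [hn₂.2.2]
    have hGI : G = Finset.Icc (G.min' hGne) (G.max' hGne) := eq_Icc_of_between hGne hbetween
    have hmG := G.min'_mem hGne
    have hMG := G.max'_mem hGne
    rw [hmemG, Finset.mem_Ioc] at hmG hMG
    rw [hGI]
    exact H.kl_interval hlam hδ hδ2 hmG.1.1 hMG.1.2 hmG.2.1 hMG.2.2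
  rw [hsplit]
  calc ‖∑ n ∈ F.filter P, e (φ n) + (∑ n ∈ (F.filter (fun n : ℤ => ¬ P n)).filter Q, e (φ n)
        + ∑ n ∈ (F.filter (fun n : ℤ => ¬ P n)).filter (fun n : ℤ => ¬ Q n), e (φ n))‖
      ≤ ‖∑ n ∈ F.filter P, e (φ n)‖ + (‖∑ n ∈ (F.filter (fun n : ℤ => ¬ P n)).filter Q, e (φ n)‖
        + ‖∑ n ∈ (F.filter (fun n : ℤ => ¬ P n)).filter (fun n : ℤ => ¬ Q n), e (φ n)‖) := by
        refine (norm_add_le _ _).trans ?_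
        gcongr
        exact norm_add_le _ _
    _ ≤ (δ / lam + 1) + (2 / δ + (δ / lam + 1)) := by
        gcongr
        · exact (norm_sum_e_le_card _ (fun n => φ n)).trans hA
        · exact (norm_sum_e_le_card _ (fun n => φ n)).trans hB
    _ = 2 * (δ / lam + 1) + 2 / δ := by ring

/-- The number of fibres: `#{⌊θ(n)⌋ : a < n ≤ b} ≤ h λ (b - a) + 2`. [cite: GrahamKolesnik1991, Thm 2.2 (proof)] -/
theorem card_fibres_le (H : SecondDiffHyp φ a b lam h) (hlam : 0 < lam) (hh : 1 ≤ h) (hab : a ≤ b) :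
    (((Finset.Ioc a b).image (fun n : ℤ => ⌊φ (n + 1) - φ n⌋)).card : ℝ) ≤ h * lam * (b - a) + 2 := by
  have hab' : ((a : ℤ) : ℝ) ≤ b := by exact_mod_cast hab
  set θ : ℤ → ℝ := fun n => φ (n + 1) - φ n with hθdef
  set g : ℤ → ℤ := fun n => ⌊θ n⌋ with hgdef
  rcases (Finset.Ioc a b).eq_empty_or_nonempty with hemp | hne
  · rw [hemp, Finset.image_empty, Finset.card_empty]; push_cast
    nlinarith [mul_nonneg (mul_nonneg (zero_le_one.trans hh) hlam.le) (sub_nonneg.2 hab')]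
  have hab1 : a < b := by
    obtain ⟨n, hn⟩ := hne; rw [Finset.mem_Ioc] at hn; omega
  have hsub : (Finset.Ioc a b).image g ⊆ Finset.Icc (g (a + 1)) (g b) := by
    intro ν hν
    rw [Finset.mem_image] at hν
    obtain ⟨n, hn, rfl⟩ := hν
    rw [Finset.mem_Ioc] at hn
    rw [Finset.mem_Icc]
    constructor
    · exact Int.floor_mono (H.mono hlam (by omega) (by omega) hn.2)
    · exact Int.floor_mono (H.mono hlam hn.1 hn.2 le_rfl)
  have hgab : g (a + 1) ≤ g b := Int.floor_mono (H.mono hlam (by omega) (by omega) le_rfl)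
  have hdiff : ((g b : ℤ) : ℝ) - g (a + 1) ≤ h * lam * (b - a) + 1 := by
    have h1 : ((g b : ℤ) : ℝ) ≤ θ b := Int.floor_le _
    have h2 : θ (a + 1) < g (a + 1) + 1 := Int.lt_floor_add_one _
    have h4 := (H.incr (a + 1) b (by omega) (by omega) le_rfl).2
    have h6 : h * lam * ((b : ℝ) - ((a + 1 : ℤ) : ℝ)) ≤ h * lam * (b - a) := by
      apply mul_le_mul_of_nonneg_left _ (by positivity)
      push_cast; linarith
    simp only [hθdef] at h1 h2
    linarith
  calc (((Finset.Ioc a b).image g).card : ℝ) ≤ ((Finset.Icc (g (a + 1)) (g b)).card : ℝ) := by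
        exact_mod_cast Finset.card_le_card hsub
    _ ≤ (((g b : ℤ) : ℝ) - g (a + 1)) + 1 := by
        apply card_le_of_diam (by
          have : ((g (a + 1) : ℤ) : ℝ) ≤ g b := by exact_mod_cast hgab
          linarith)
        intro n₁ hn₁ n₂ hn₂ _
        rw [Finset.mem_Icc] at hn₁ hn₂
        have e1 : ((n₂ : ℤ) : ℝ) ≤ g b := by exact_mod_cast hn₂.2
        have e2 : ((g (a + 1) : ℤ) : ℝ) ≤ n₁ := by exact_mod_cast hn₁.1
        linarith
    _ ≤ h * lam * (b - a) + 2 := by linarith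

end SecondDiffHyp

/-! ### The discrete second-derivative test -/

/-- **Van der Corput's second-derivative test, discrete core form.**  If the increments
`θ(n) = φ(n+1) - φ(n)` satisfy `λ(n₂ - n₁) ≤ θ(n₂) - θ(n₁) ≤ hλ(n₂ - n₁)` for `a < n₁ ≤ n₂ ≤ b`
(`λ > 0`, `h ≥ 1`), then `‖∑_{a<n≤b} e(φ(n))‖ ≤ 12 (h (b - a) λ^{1/2} + λ^{-1/2})`.
[cite: GrahamKolesnik1991, Thm 2.2 (van der Corput)] -/
theorem secondDiffTest_core {φ : ℤ → ℝ} {a b : ℤ} {lam h : ℝ} (hab : a ≤ b)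
    (hlam : 0 < lam) (hh : 1 ≤ h) (H : SecondDiffHyp φ a b lam h) :
    ‖∑ n ∈ Finset.Ioc a b, e (φ n)‖
      ≤ 12 * (h * ((b : ℝ) - a) * Real.sqrt lam + 1 / Real.sqrt lam) := by
  have hsq : 0 < Real.sqrt lam := Real.sqrt_pos.2 hlam
  have hab' : (a : ℝ) ≤ b := by exact_mod_cast hab
  have hL0 : (0 : ℝ) ≤ (b : ℝ) - a := by linarith
  set L : ℝ := (b : ℝ) - a with hLdef
  -- trivial bound
  have htriv : ‖∑ n ∈ Finset.Ioc a b, e (φ n)‖ ≤ L := by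
    refine (norm_sum_e_le_card _ (fun n => φ n)).trans ?_
    rw [Int.card_Ioc, hLdef]
    have h1 : (((b - a).toNat : ℕ) : ℤ) = b - a := Int.toNat_of_nonneg (by linarith)
    have h2 : (((b - a).toNat : ℕ) : ℝ) = ((b - a : ℤ) : ℝ) := by exact_mod_cast h1
    rw [h2]; push_cast; exact le_rfl
  -- Case `λ > 1/4`: the trivial bound suffices.
  rcases lt_or_ge (1 / 4 : ℝ) lam with hbig | hsmall
  · have hs2 : 1 / 2 < Real.sqrt lam := by
      rw [show (1 / 2 : ℝ) = Real.sqrt (1 / 4) by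
        rw [show (1 / 4 : ℝ) = (1 / 2) ^ 2 by norm_num, Real.sqrt_sq (by norm_num)]]
      exact Real.sqrt_lt_sqrt (by norm_num) hbig
    refine htriv.trans ?_
    have h1 : 1 / 2 ≤ h * Real.sqrt lam := by
      have : Real.sqrt lam ≤ h * Real.sqrt lam := by
        calc Real.sqrt lam = 1 * Real.sqrt lam := (one_mul _).symm
          _ ≤ h * Real.sqrt lam := mul_le_mul_of_nonneg_right hh hsq.le
      linarith
    have h2 : L * (1 / 2) ≤ L * (h * Real.sqrt lam) := mul_le_mul_of_nonneg_left h1 hL0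
    have h3 : 0 < 1 / Real.sqrt lam := by positivity
    nlinarith [h2, h3]
  -- Main case `λ ≤ 1/4`, `δ = √λ ≤ 1/2`.
  set δ : ℝ := Real.sqrt lam with hδdef
  have hδ : 0 < δ := hsq
  have hδsq : δ ^ 2 = lam := Real.sq_sqrt hlam.le
  have hδ2 : δ ≤ 1 / 2 := by
    rw [hδdef, show (1 / 2 : ℝ) = Real.sqrt (1 / 4) by
      rw [show (1 / 4 : ℝ) = (1 / 2) ^ 2 by norm_num, Real.sqrt_sq (by norm_num)]]
    exact Real.sqrt_le_sqrt hsmall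
  have hδlam : δ / lam = 1 / δ := by
    rw [← hδsq]; field_simp
  have hlamδ : lam / δ = δ := by
    rw [← hδsq]; field_simp
  have h2δ : (2 : ℝ) ≤ 1 / δ := by rw [le_div_iff₀ hδ]; linarith
  set g : ℤ → ℤ := fun n => ⌊φ (n + 1) - φ n⌋ with hgdef
  set V : Finset ℤ := (Finset.Ioc a b).image g with hVdef
  have hfib : ∑ n ∈ Finset.Ioc a b, e (φ n)
      = ∑ ν ∈ V, ∑ n ∈ (Finset.Ioc a b).filter (fun n : ℤ => g n = ν), e (φ n) :=
    (Finset.sum_fiberwise_of_maps_to (fun n hn => Finset.mem_image_of_mem g hn) _).symm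
  have hcardV : (V.card : ℝ) ≤ h * lam * L + 2 := H.card_fibres_le hlam hh hab
  rw [hfib]
  calc ‖∑ ν ∈ V, ∑ n ∈ (Finset.Ioc a b).filter (fun n : ℤ => g n = ν), e (φ n)‖
      ≤ ∑ ν ∈ V, ‖∑ n ∈ (Finset.Ioc a b).filter (fun n : ℤ => g n = ν), e (φ n)‖ := norm_sum_le _ _
    _ ≤ ∑ ν ∈ V, (2 * (δ / lam + 1) + 2 / δ) :=
        Finset.sum_le_sum fun ν _ => H.fibre_bound hlam ν hδ hδ2
    _ = V.card * (2 * (δ / lam + 1) + 2 / δ) := by rw [Finset.sum_const, nsmul_eq_mul]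
    _ ≤ (h * lam * L + 2) * (2 * (δ / lam + 1) + 2 / δ) := by
        apply mul_le_mul_of_nonneg_right hcardV; positivity
    _ = (h * lam * L + 2) * (4 * (1 / δ) + 2) := by rw [hδlam]; ring
    _ ≤ (h * lam * L + 2) * (5 * (1 / δ)) := by
        apply mul_le_mul_of_nonneg_left _ (by positivity)
        linarith
    _ = 5 * (h * L * (lam / δ)) + 10 * (1 / δ) := by ring
    _ = 5 * (h * L * δ) + 10 * (1 / δ) := by rw [hlamδ]
    _ ≤ 12 * (h * L * δ + 1 / δ) := by
        have : 0 ≤ h * L * δ := by positivity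
        have : 0 ≤ 1 / δ := by positivity
        nlinarith

/-- From local second differences to increments: if `λ ≤ φ(n+2) - 2φ(n+1) + φ(n) ≤ hλ` for `a < n`,
`n + 1 ≤ b`, then `SecondDiffHyp φ a b λ h`. [folklore] -/
theorem secondDiffHyp_of_local {φ : ℤ → ℝ} {a b : ℤ} {lam h : ℝ}
    (h2 : ∀ n : ℤ, a < n → n + 1 ≤ b →
      lam ≤ φ (n + 2) - 2 * φ (n + 1) + φ n ∧ φ (n + 2) - 2 * φ (n + 1) + φ n ≤ h * lam) :
    SecondDiffHyp φ a b lam h := by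
  constructor
  intro n₁ n₂ h₁ h12 h₂
  -- induction on `n₂ - n₁`
  obtain ⟨k, rfl⟩ : ∃ k : ℕ, n₂ = n₁ + k := ⟨(n₂ - n₁).toNat, by omega⟩
  clear h12
  induction k with
  | zero => simp
  | succ k ih =>
    have hk : n₁ + (k : ℤ) ≤ b := by push_cast at h₂; omega
    obtain ⟨ih1, ih2⟩ := ih hk
    have hloc := h2 (n₁ + k) (by omega) (by push_cast at h₂ ⊢; omega)
    have e1 : φ (n₁ + ((k + 1 : ℕ) : ℤ) + 1) = φ (n₁ + k + 2) := by congr 1; push_cast; ring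
    have e2 : φ (n₁ + ((k + 1 : ℕ) : ℤ)) = φ (n₁ + k + 1) := by congr 1; push_cast; ring
    rw [e1, e2]
    push_cast at ih1 ih2 ⊢
    constructor <;> linarith [ih1, ih2, hloc.1, hloc.2]

/-- **Van der Corput's second-derivative test, discrete form.**  If `λ ≤ φ(n+2) - 2φ(n+1) + φ(n) ≤ hλ`
for `a < n`, `n + 1 ≤ b` (`λ > 0`, `h ≥ 1`, `a ≤ b`), then
`‖∑_{a<n≤b} e(φ(n))‖ ≤ 12 (h (b - a) λ^{1/2} + λ^{-1/2})`. [cite: GrahamKolesnik1991, Thm 2.2 (van der Corput)] -/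
theorem secondDiffTest {φ : ℤ → ℝ} {a b : ℤ} {lam h : ℝ} (hab : a ≤ b) (hlam : 0 < lam) (hh : 1 ≤ h)
    (h2 : ∀ n : ℤ, a < n → n + 1 ≤ b →
      lam ≤ φ (n + 2) - 2 * φ (n + 1) + φ n ∧ φ (n + 2) - 2 * φ (n + 1) + φ n ≤ h * lam) :
    ‖∑ n ∈ Finset.Ioc a b, e (φ n)‖
      ≤ 12 * (h * ((b : ℝ) - a) * Real.sqrt lam + 1 / Real.sqrt lam) :=
  secondDiffTest_core hab hlam hh (secondDiffHyp_of_local h2)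

/-- **Discrete second-derivative test, interior form**: the same bound `+ 1`, assuming the second-difference
bounds only for the triples `n, n+1, n+2` inside `(a, b]` (the last term is estimated trivially).
[cite: GrahamKolesnik1991, Thm 2.2 (van der Corput)] -/
theorem secondDiffTest' {φ : ℤ → ℝ} {a b : ℤ} {lam h : ℝ} (hab : a ≤ b) (hlam : 0 < lam) (hh : 1 ≤ h)
    (h2 : ∀ n : ℤ, a < n → n + 2 ≤ b →
      lam ≤ φ (n + 2) - 2 * φ (n + 1) + φ n ∧ φ (n + 2) - 2 * φ (n + 1) + φ n ≤ h * lam) :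
    ‖∑ n ∈ Finset.Ioc a b, e (φ n)‖
      ≤ 12 * (h * ((b : ℝ) - a) * Real.sqrt lam + 1 / Real.sqrt lam) + 1 := by
  have hsq : 0 < Real.sqrt lam := Real.sqrt_pos.2 hlam
  rcases eq_or_lt_of_le hab with h0 | hlt
  · subst h0; simp; positivity
  have hIoc : Finset.Ioc a b = insert b (Finset.Ioc a (b - 1)) := by
    ext n; simp only [Finset.mem_Ioc, Finset.mem_insert]; omega
  have hnot : b ∉ Finset.Ioc a (b - 1) := by simp
  rw [hIoc, Finset.sum_insert hnot]
  have hmain := secondDiffTest (a := a) (b := b - 1) (by omega) hlam hh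
    (fun n hn1 hn2 => h2 n hn1 (by omega))
  have hab' : ((b - 1 : ℤ) : ℝ) - a ≤ (b : ℝ) - a := by push_cast; linarith
  calc ‖e (φ b) + ∑ n ∈ Finset.Ioc a (b - 1), e (φ n)‖
      ≤ ‖e (φ b)‖ + ‖∑ n ∈ Finset.Ioc a (b - 1), e (φ n)‖ := norm_add_le _ _
    _ ≤ 1 + 12 * (h * (((b - 1 : ℤ) : ℝ) - a) * Real.sqrt lam + 1 / Real.sqrt lam) := by
        rw [norm_e]; exact add_le_add le_rfl hmain
    _ ≤ 12 * (h * ((b : ℝ) - a) * Real.sqrt lam + 1 / Real.sqrt lam) + 1 := by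
        have : h * (((b - 1 : ℤ) : ℝ) - a) * Real.sqrt lam ≤ h * ((b : ℝ) - a) * Real.sqrt lam := by
          apply mul_le_mul_of_nonneg_right _ hsq.le
          exact mul_le_mul_of_nonneg_left hab' (by linarith)
        linarith

/-! ### Abel summation with an amplitude of bounded variation -/

/-- **Summation by parts** with the tail sums `S(m) = ∑_{m<n≤b} z(n)`:
`∑_{a<n≤b} A(n) z(n) = A(a+1) S(a) + ∑_{a<m<b} (A(m+1) - A(m)) S(m)` (`a ≤ b`). [folklore] -/
theorem sum_Ioc_mul_eq_abel (A z : ℤ → ℂ) {a b : ℤ} (hab : a ≤ b) :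
    ∑ n ∈ Finset.Ioc a b, A n * z n
      = A (a + 1) * (∑ n ∈ Finset.Ioc a b, z n)
        + ∑ m ∈ Finset.Ioo a b, (A (m + 1) - A m) * ∑ n ∈ Finset.Ioc m b, z n := by
  obtain ⟨k, rfl⟩ : ∃ k : ℕ, a = b - k := ⟨(b - a).toNat, by omega⟩
  clear hab
  induction k with
  | zero => simp
  | succ k ih =>
    -- peel off the first term `n = b - k`
    have hIoc : Finset.Ioc (b - ((k + 1 : ℕ) : ℤ)) b = insert (b - k) (Finset.Ioc (b - (k : ℤ)) b) := by
      ext n; simp only [Finset.mem_Ioc, Finset.mem_insert]; push_cast; omega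
    have hnot : b - (k : ℤ) ∉ Finset.Ioc (b - (k : ℤ)) b := by simp
    have hIoo : Finset.Ioo (b - ((k + 1 : ℕ) : ℤ)) b = insert (b - k) (Finset.Ioo (b - (k : ℤ)) b) ∨
        (k = 0 ∧ Finset.Ioo (b - ((k + 1 : ℕ) : ℤ)) b = ∅) := by
      rcases Nat.eq_zero_or_pos k with hk | hk
      · right; refine ⟨hk, ?_⟩; subst hk; ext n; simp only [Finset.mem_Ioo]; push_cast
        simp only [Finset.notMem_empty, iff_false, not_and, not_lt]; intro h; omega
      · left; ext n; simp only [Finset.mem_Ioo, Finset.mem_insert]; push_cast; omega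
    have hnot' : b - (k : ℤ) ∉ Finset.Ioo (b - (k : ℤ)) b := by simp
    have e1 : b - ((k + 1 : ℕ) : ℤ) + 1 = b - k := by push_cast; ring
    rw [hIoc, Finset.sum_insert hnot, Finset.sum_insert hnot, ih, e1]
    rcases hIoo with h | ⟨hk, h⟩
    · rw [h, Finset.sum_insert hnot']
      ring
    · subst hk
      simp only [Nat.cast_zero, sub_zero, zero_add, Nat.cast_one] at h ⊢
      simp [h]

/-- **Abel summation, bounded-variation form.**  For `a ≤ b` and `A, z : ℤ → ℂ`: if
`‖∑_{m<n≤b} z(n)‖ ≤ B` for all `a ≤ m ≤ b`, then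
`‖∑_{a<n≤b} A(n) z(n)‖ ≤ (‖A(a+1)‖ + ∑_{a<m<b} ‖A(m+1) - A(m)‖) · B`. [folklore] -/
theorem norm_sum_mul_le_of_variation (A z : ℤ → ℂ) {a b : ℤ} (hab : a ≤ b) {B : ℝ}
    (hz : ∀ m : ℤ, a ≤ m → m ≤ b → ‖∑ n ∈ Finset.Ioc m b, z n‖ ≤ B) :
    ‖∑ n ∈ Finset.Ioc a b, A n * z n‖
      ≤ (‖A (a + 1)‖ + ∑ m ∈ Finset.Ioo a b, ‖A (m + 1) - A m‖) * B := by
  rw [sum_Ioc_mul_eq_abel A z hab, add_mul, Finset.sum_mul]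
  refine (norm_add_le _ _).trans (add_le_add ?_ ((norm_sum_le _ _).trans (Finset.sum_le_sum fun m hm => ?_)))
  · rw [norm_mul]; exact mul_le_mul_of_nonneg_left (hz a le_rfl hab) (norm_nonneg _)
  · rw [Finset.mem_Ioo] at hm
    rw [norm_mul]; exact mul_le_mul_of_nonneg_left (hz m hm.1.le hm.2.le) (norm_nonneg _)

/-! ### Sums with gaps: runs of a "deep" set -/

/-- Splitting a sum over `(a, b]` at `c`. [folklore] -/
theorem sum_Ioc_split {M : Type*} [AddCommMonoid M] (f : ℤ → M) {a c b : ℤ} (hac : a ≤ c) (hcb : c ≤ b) :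
    ∑ n ∈ Finset.Ioc a b, f n = ∑ n ∈ Finset.Ioc a c, f n + ∑ n ∈ Finset.Ioc c b, f n := by
  rw [← Finset.sum_filter_add_sum_filter_not (Finset.Ioc a b) (fun n => n ≤ c)]
  congr 1
  · congr 1; ext n; simp only [Finset.mem_filter, Finset.mem_Ioc]; omega
  · congr 1; ext n; simp only [Finset.mem_filter, Finset.mem_Ioc, not_le]; omega

/-- **Abel summation plus the second-difference test on the runs of a set with gaps.**  Let `D ⊆ (a, b]`,
let `A` vanish on `(a, b] ∖ D` and at the first element of every maximal run of consecutive integers of `D`,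
`‖A(n+1) - A(n)‖ ≤ δ` for consecutive `n, n+1 ∈ D`, and `μ ≤ q(n+2) - 2q(n+1) + q(n) ≤ hμ` for consecutive
triples in `D` (`μ > 0`, `h ≥ 1`, `δ ≥ 0`).  Then
`‖∑_{a<n≤b} A(n) e(q(n))‖ ≤ δ (b - a) (12 (h (b - a) μ^{1/2} + μ^{-1/2}) + 1)`
(induction on the runs: on a run, Abel summation `norm_sum_mul_le_of_variation` and `secondDiffTest'`). [folklore] -/
theorem norm_sum_gapped_le {A : ℤ → ℂ} {q : ℤ → ℝ} {δ μ h : ℝ} (hμ : 0 < μ) (hh : 1 ≤ h) (hδ : 0 ≤ δ)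
    (k : ℕ) : ∀ (a b : ℤ) (D : Finset ℤ), b - a ≤ k → a ≤ b → D ⊆ Finset.Ioc a b →
      (∀ n ∈ Finset.Ioc a b, n ∉ D → A n = 0) →
      (∀ n ∈ D, n - 1 ∉ D → A n = 0) →
      (∀ n ∈ D, n + 1 ∈ D → ‖A (n + 1) - A n‖ ≤ δ) →
      (∀ n ∈ D, n + 1 ∈ D → n + 2 ∈ D →
        μ ≤ q (n + 2) - 2 * q (n + 1) + q n ∧ q (n + 2) - 2 * q (n + 1) + q n ≤ h * μ) →
      ‖∑ n ∈ Finset.Ioc a b, A n * e (q n)‖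
        ≤ δ * ((b : ℝ) - a) * (12 * (h * ((b : ℝ) - a) * Real.sqrt μ + 1 / Real.sqrt μ) + 1) := by
  induction k using Nat.strong_induction_on with
  | _ k ih =>
  intro a b D hk hab hD hA0 hstart hvar h2
  have hsq : 0 < Real.sqrt μ := Real.sqrt_pos.2 hμ
  have hab' : (a : ℝ) ≤ b := by exact_mod_cast hab
  have hba0 : 0 ≤ (b : ℝ) - a := by linarith
  set B₀ : ℝ := 12 * (h * ((b : ℝ) - a) * Real.sqrt μ + 1 / Real.sqrt μ) + 1 with hB₀
  have hB₀0 : 0 ≤ B₀ := by positivity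
  rcases D.eq_empty_or_nonempty with hDe | hDne
  · -- no deep terms: the sum vanishes
    have : ∑ n ∈ Finset.Ioc a b, A n * e (q n) = 0 :=
      Finset.sum_eq_zero fun n hn => by rw [hA0 n hn (by simp [hDe]), zero_mul]
    rw [this, norm_zero]
    positivity
  -- the first run `[n₀, n₁]`
  set n₀ : ℤ := D.min' hDne with hn₀
  have hn₀D : n₀ ∈ D := D.min'_mem hDne
  have hn₀min : ∀ n ∈ D, n₀ ≤ n := fun n hn => D.min'_le n hn
  have hn₀I := Finset.mem_Ioc.1 (hD hn₀D)
  set S : Finset ℤ := (Finset.Icc n₀ b).filter (fun n => ∀ m ∈ Finset.Icc n₀ n, m ∈ D) with hS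
  have hn₀S : n₀ ∈ S := by
    rw [hS, Finset.mem_filter, Finset.mem_Icc]
    exact ⟨⟨le_rfl, hn₀I.2⟩, fun m hm => by rw [Finset.mem_Icc] at hm; rwa [show m = n₀ by omega]⟩
  have hSne : S.Nonempty := ⟨n₀, hn₀S⟩
  set n₁ : ℤ := S.max' hSne with hn₁
  have hn₁S : n₁ ∈ S := S.max'_mem hSne
  rw [hS, Finset.mem_filter, Finset.mem_Icc] at hn₁S
  have hrun : ∀ m : ℤ, n₀ ≤ m → m ≤ n₁ → m ∈ D := fun m h1 h2 => hn₁S.2 m (Finset.mem_Icc.2 ⟨h1, h2⟩)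
  have hn₁b : n₁ ≤ b := hn₁S.1.2
  have hn₀n₁ : n₀ ≤ n₁ := hn₁S.1.1
  have hend : n₁ = b ∨ n₁ + 1 ∉ D := by
    by_contra hcon
    rw [not_or, not_not] at hcon
    have hmem : n₁ + 1 ∈ S := by
      rw [hS, Finset.mem_filter, Finset.mem_Icc]
      refine ⟨⟨by omega, by omega⟩, fun m hm => ?_⟩
      rw [Finset.mem_Icc] at hm
      rcases eq_or_lt_of_le hm.2 with h' | h'
      · rw [h']; exact hcon.2
      · exact hrun m hm.1 (by omega)
    have := S.le_max' _ hmem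
    rw [← hn₁] at this
    omega
  -- ### the run sum
  have hrunsum : ‖∑ n ∈ Finset.Ioc (n₀ - 1) n₁, A n * e (q n)‖ ≤ δ * ((n₁ : ℝ) - n₀) * B₀ := by
    -- exponential sums over tails of the run
    have htail : ∀ m : ℤ, n₀ - 1 ≤ m → m ≤ n₁ → ‖∑ n ∈ Finset.Ioc m n₁, e (q n)‖ ≤ B₀ := by
      intro m hm1 hm2
      have hb := secondDiffTest' (φ := q) (a := m) (b := n₁) hm2 hμ hh (fun n hn1 hn2 =>
        h2 n (hrun n (by omega) (by omega)) (hrun (n + 1) (by omega) (by omega)) (hrun (n + 2) (by omega) hn2))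
      refine hb.trans ?_
      rw [hB₀]
      have : h * ((n₁ : ℝ) - m) * Real.sqrt μ ≤ h * ((b : ℝ) - a) * Real.sqrt μ := by
        apply mul_le_mul_of_nonneg_right _ hsq.le
        apply mul_le_mul_of_nonneg_left _ (by linarith)
        have : ((n₁ : ℤ) : ℝ) ≤ b := by exact_mod_cast hn₁b
        have : ((a : ℤ) : ℝ) ≤ m := by exact_mod_cast (show a ≤ m by omega)
        linarith
      linarith
    have habel := norm_sum_mul_le_of_variation A (fun n => e (q n)) (show n₀ - 1 ≤ n₁ by omega) htail
    refine habel.trans ?_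
    rw [show n₀ - 1 + 1 = n₀ by ring, hstart n₀ hn₀D (fun hmem => by have := hn₀min _ hmem; omega),
      norm_zero, zero_add]
    have hv : ∑ m ∈ Finset.Ioo (n₀ - 1) n₁, ‖A (m + 1) - A m‖ ≤ δ * ((n₁ : ℝ) - n₀) := by
      calc ∑ m ∈ Finset.Ioo (n₀ - 1) n₁, ‖A (m + 1) - A m‖ ≤ ∑ m ∈ Finset.Ioo (n₀ - 1) n₁, δ :=
            Finset.sum_le_sum fun m hm => by
              rw [Finset.mem_Ioo] at hm
              exact hvar m (hrun m (by omega) (by omega)) (hrun (m + 1) (by omega) (by omega))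
        _ = δ * ((n₁ : ℝ) - n₀) := by
            rw [Finset.sum_const, nsmul_eq_mul, Int.card_Ioo]
            have e1 : (((n₁ - (n₀ - 1) - 1).toNat : ℕ) : ℝ) = ((n₁ - (n₀ - 1) - 1 : ℤ) : ℝ) := by
              exact_mod_cast Int.toNat_of_nonneg (by omega)
            rw [e1]; push_cast; ring
    exact mul_le_mul_of_nonneg_right hv hB₀0
  -- ### the remaining sum, by induction
  set D' : Finset ℤ := D.filter (fun n => n₁ < n) with hD'
  have hrest : ‖∑ n ∈ Finset.Ioc n₁ b, A n * e (q n)‖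
      ≤ δ * ((b : ℝ) - n₁) * (12 * (h * ((b : ℝ) - n₁) * Real.sqrt μ + 1 / Real.sqrt μ) + 1) := by
    have hlt : ((b - n₁).toNat : ℕ) < k := by
      have : b - n₁ < b - a := by omega
      have h0 : 0 ≤ b - n₁ := by omega
      zify; rw [Int.toNat_of_nonneg h0]; omega
    refine ih _ hlt n₁ b D' (by rw [Int.toNat_of_nonneg (by omega)]) hn₁b ?_ ?_ ?_ ?_ ?_
    · intro n hn
      rw [hD', Finset.mem_filter] at hn
      have := Finset.mem_Ioc.1 (hD hn.1)
      exact Finset.mem_Ioc.2 ⟨hn.2, this.2⟩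
    · intro n hn hnD'
      rw [Finset.mem_Ioc] at hn
      apply hA0 n (Finset.mem_Ioc.2 ⟨by omega, hn.2⟩)
      intro hnD
      exact hnD' (by rw [hD', Finset.mem_filter]; exact ⟨hnD, hn.1⟩)
    · intro n hn hprev
      rw [hD', Finset.mem_filter] at hn
      by_cases hp : n - 1 ∈ D
      · -- then `n - 1 = n₁`, so `n = n₁ + 1 ∈ D`, contradicting `hend`
        have hle : n - 1 ≤ n₁ := by
          by_contra hgt
          exact hprev (by rw [hD', Finset.mem_filter]; exact ⟨hp, by omega⟩)
        have heq : n = n₁ + 1 := by omega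
        rcases hend with h' | h'
        · have := Finset.mem_Ioc.1 (hD hn.1); omega
        · exact absurd (heq ▸ hn.1) h'
      · exact hstart n hn.1 hp
    · intro n hn hn1
      rw [hD', Finset.mem_filter] at hn hn1
      exact hvar n hn.1 hn1.1
    · intro n hn hn1 hn2
      rw [hD', Finset.mem_filter] at hn hn1 hn2
      exact h2 n hn.1 hn1.1 hn2.1
  -- ### assembly
  have hfirst : ∑ n ∈ Finset.Ioc a n₁, A n * e (q n) = ∑ n ∈ Finset.Ioc (n₀ - 1) n₁, A n * e (q n) := by
    symm
    refine Finset.sum_subset (Finset.Ioc_subset_Ioc (by omega) le_rfl) fun n hn hn' => ?_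
    rw [Finset.mem_Ioc] at hn hn'
    have hnD : n ∉ D := fun h' => hn' ⟨by have := hn₀min n h'; omega, hn.2⟩
    rw [hA0 n (Finset.mem_Ioc.2 ⟨hn.1, by omega⟩) hnD, zero_mul]
  rw [sum_Ioc_split _ (show a ≤ n₁ by omega) hn₁b, hfirst]
  refine (norm_add_le _ _).trans ?_
  have hB₁ : 12 * (h * ((b : ℝ) - n₁) * Real.sqrt μ + 1 / Real.sqrt μ) + 1 ≤ B₀ := by
    rw [hB₀]
    have : h * ((b : ℝ) - n₁) * Real.sqrt μ ≤ h * ((b : ℝ) - a) * Real.sqrt μ := by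
      apply mul_le_mul_of_nonneg_right _ hsq.le
      apply mul_le_mul_of_nonneg_left _ (by linarith)
      have : ((a : ℤ) : ℝ) ≤ n₁ := by exact_mod_cast (show a ≤ n₁ by omega)
      linarith
    linarith
  have hn₁r : ((a : ℤ) : ℝ) ≤ n₁ := by exact_mod_cast (show a ≤ n₁ by omega)
  have hn₀r : ((a : ℤ) : ℝ) ≤ n₀ - 1 := by
    have : ((a : ℤ) : ℝ) + 1 ≤ n₀ := by exact_mod_cast (show a + 1 ≤ n₀ by omega)
    linarith
  have hbn₁ : ((n₁ : ℤ) : ℝ) ≤ b := by exact_mod_cast hn₁b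
  calc ‖∑ n ∈ Finset.Ioc (n₀ - 1) n₁, A n * e (q n)‖ + ‖∑ n ∈ Finset.Ioc n₁ b, A n * e (q n)‖
      ≤ δ * ((n₁ : ℝ) - n₀) * B₀ + δ * ((b : ℝ) - n₁) * B₀ := by
        refine add_le_add hrunsum (hrest.trans ?_)
        exact mul_le_mul_of_nonneg_left hB₁ (mul_nonneg hδ (by linarith))
    _ = δ * (((n₁ : ℝ) - n₀) + ((b : ℝ) - n₁)) * B₀ := by ring
    _ ≤ δ * ((b : ℝ) - a) * B₀ := by
        apply mul_le_mul_of_nonneg_right _ hB₀0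
        apply mul_le_mul_of_nonneg_left _ hδ
        linarith

/-- **Sums with gaps**, packaged form of `norm_sum_gapped_le`. [folklore] -/
theorem norm_sum_gapped_le' {A : ℤ → ℂ} {q : ℤ → ℝ} {D : Finset ℤ} {a b : ℤ} {δ μ h : ℝ}
    (hμ : 0 < μ) (hh : 1 ≤ h) (hδ : 0 ≤ δ) (hab : a ≤ b) (hD : D ⊆ Finset.Ioc a b)
    (hA0 : ∀ n ∈ Finset.Ioc a b, n ∉ D → A n = 0)
    (hstart : ∀ n ∈ D, n - 1 ∉ D → A n = 0)
    (hvar : ∀ n ∈ D, n + 1 ∈ D → ‖A (n + 1) - A n‖ ≤ δ)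
    (h2 : ∀ n ∈ D, n + 1 ∈ D → n + 2 ∈ D →
      μ ≤ q (n + 2) - 2 * q (n + 1) + q n ∧ q (n + 2) - 2 * q (n + 1) + q n ≤ h * μ) :
    ‖∑ n ∈ Finset.Ioc a b, A n * e (q n)‖
      ≤ δ * ((b : ℝ) - a) * (12 * (h * ((b : ℝ) - a) * Real.sqrt μ + 1 / Real.sqrt μ) + 1) :=
  norm_sum_gapped_le hμ hh hδ (b - a).toNat a b D (by rw [Int.toNat_of_nonneg (by omega)]) hab hD hA0 hstart hvar h2


end VdC
end Literature.NumberTheory.LFunctions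

end
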